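import Mathlib

/-!
# Solo (informed) rung s27/2: the ray profile of the two-strand model

Setting (paper §16.13(i),(j)): `F` totally real cubic, `7 ∤ h_F`, `7` inert, `η` a unit of `F`
that is not a local seventh power at the prime above `7`, `K = F(ζ₇)`, `L = K(η^{1/7})`,
`Γ = Gal(L/F) = G ⋊ Δ`.  The class module `Cl(L)/7` is a sum of Jordan strands of
`T = g - 1` with top `Δ`-characters `ω^t`, `t ∈ T ⊆ {1, …, 5}`, and lengths `ℓ_t ∈ [1, 7]`;
for a standard field `T = {3, 5}`.  By Poitou–Tate duality and the Shapiro–CFT dictionary,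
the ray dimensions of the census satisfy
`V_k = 1 + 3⌈k/2⌉ - [k = 5] + N_k - [k = 5]·ν` (`0 ≤ k ≤ 6`), where `N_k` is the number of
`Γ`-equivariant maps from the strands onto pieces of the uniserial module
`M_k^* = Hom(Fil_k, μ₇) = [ω¹; ω²; …; ω^{k+1}]`: a map whose image has colength `i ≤ k` needs
top character `ω^{1+i} = ω^t` and `ℓ_t ≥ k + 1 - i`.  Two finite statements used there as
registered predictions are certified here.

* `soloInformed_ray_pairs`: for a single strand with top `ω^t` (`1 ≤ t ≤ 5`) and length `ℓ`,
  the number of admissible colengths `i ≤ k` is `[t ≤ k + 1 ∧ ℓ ≥ k + 2 - t] + [k = 6 ∧ t = 1]`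
  (the second term is the colength-`6` map onto the socle of `M_6^* = 𝔽₇[G] ⊗ ω`).
* `soloInformed_ray_profile`: for `T = {3, 5}` the resulting profile
  `k ↦ 1 + 3⌈k/2⌉ - [k = 5] + N_k` is
  `(1, 4, 5, 7 + [ℓ₃ ≥ 2], 8 + [ℓ₃ ≥ 3], 9 + [ℓ₃ ≥ 4] + [ℓ₅ ≥ 2], 10 + [ℓ₃ ≥ 5] + [ℓ₅ ≥ 3])`,
  the closed form verified on `1110 / 1112` inert census lines in §16.13(j) (the remaining
  `ν`-correction at `k = 5` is the class of the prime above `7` in `F_η`).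

Informal prediction, not formalised: `V₅(η) = 9 + [cubic] + [package] - ν(η)` and
`r7(η) = 10 + [ℓ₃ ≥ 5] + [ℓ₅ ≥ 3]`.
-/

namespace Summit.Langlands.Langlands.Theorems

open Finset

/-- One strand with top `ω^t`, `1 ≤ t ≤ 5`, length `ℓ ≤ 7`: admissible colengths `i ≤ k` of a
`Γ`-map onto a piece of `[ω¹; …; ω^{k+1}]`. -/
theorem soloInformed_ray_pairs :
    ∀ t ∈ Icc 1 5, ∀ ℓ ∈ Icc 1 7, ∀ k ≤ 6,
      ((range (k + 1)).filter (fun i => (1 + i) % 6 = t ∧ k + 1 - i ≤ ℓ)).card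
        = (if t ≤ k + 1 ∧ k + 2 - t ≤ ℓ then 1 else 0) + (if k = 6 ∧ t = 1 then 1 else 0) := by
  decide

/-- The ray profile of a standard field (`T = {3, 5}`) before the `ν`-correction at `k = 5`:
`1 + 3⌈k/2⌉ - [k = 5] + N_k` with `N_k` the two-strand count of `soloInformed_ray_pairs`. -/
theorem soloInformed_ray_profile :
    ∀ ℓ₃ ∈ Icc 1 7, ∀ ℓ₅ ∈ Icc 1 7, ∀ k ≤ 6,
      1 + 3 * ((k + 1) / 2) - (if k = 5 then 1 else 0)
        + ((range (k + 1)).filter (fun i =>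
            ((1 + i) % 6 = 3 ∧ k + 1 - i ≤ ℓ₃) ∨ ((1 + i) % 6 = 5 ∧ k + 1 - i ≤ ℓ₅))).card
        = (if k = 0 then 1 else if k = 1 then 4 else if k = 2 then 5
           else if k = 3 then 7 + (if 2 ≤ ℓ₃ then 1 else 0)
           else if k = 4 then 8 + (if 3 ≤ ℓ₃ then 1 else 0)
           else if k = 5 then 9 + (if 4 ≤ ℓ₃ then 1 else 0) + (if 2 ≤ ℓ₅ then 1 else 0)
           else 10 + (if 5 ≤ ℓ₃ then 1 else 0) + (if 3 ≤ ℓ₅ then 1 else 0)) := by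
  decide

end Summit.Langlands.Langlands.Theorems
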